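import Summits.ABC.IUTFork.Joshi.LogLinkFrobeniusTransport

/-!
# [J-IIp] Thm. 10.15.1 (3), the CONTINUITY residue: under §10.13's transport and `ϕ([a]) = [a^p]`, the Frobenius residue
# isomorphism `σ_y` satisfies `|σ_y ξ|_{K_{ϕ(y)}} = |ξ|^p_{K_y}`, and for every pair of identifications with `ℂ_p` compatible with
# the valuations up to exponents the inserted automorphism is an ISOMETRY of `ℂ_p` (located, not adjudicated)

Proof-only companion (abc-iut cell, block E «type Joshi's construction, test vs S», rung LADDER-ABC:A2.E; seat abc-iut-E-t7 gen 2,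
AUTHORS-FIRST derivable item on this seat's `Joshi/LogLinkFrobeniusTransport.lean` p430819 / `Joshi/LogLinkInsertedIso.lean` p436476)
answering the ONE residue both files and their RQ7 read leave to print (abc-iut-w5-d146 2026-08-26T09:56:32Z INFO-1: «everything is
over ring automorphisms of C; print's (3) excludes CONTINUOUS τ only»). Source: K. Joshi, arXiv:2303.01662v3 (`paper:arxiv-2303.01662`;
bib `Joshi2023ATS2Local`; unrefereed — TYPED AS A CANDIDATE), render `HOME/lit/renders/Joshi-arxiv-2303.01662/pNNNN.txt`. TAKES NO
SIDE on [IUTchIII] Cor. 3.12, on Joshi's claims, or on Mochizuki's report on them; typed ≠ proved; located ≠ adjudicated. Object-side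
file (E-PLAN R14: no `Cor312*`/`Thm311*` import); no FACT-LIST row consumed; 0 `def`s; nothing asserted — every input is a binder.

PRINT. Thm. 10.15.1 (3) (p.33 l.66–68): «There is no continuous field isomorphism `ℂ_p = K_{y_{n−1}} ≃ K_{x_can} → K_{y_n} ≃ K_{x_can} =
ℂ_p` which may be inserted into the middle row of the diagram so that each resulting square commutes.» §10.13 (p.33 l.1–12):
«`ϕ(𝔪_{y_{n−1}}) = 𝔪_{y_n}` … `ϕ([a] − p) = [ϕ(a)] − p = [a^p] − p`». §10.14 (p.33 l.13–17): «natural identification `K_{y_n} ≃ ℂ_p`».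
Thm. 10.20.1 (3) (p.35 l.55–58): «`|p|_{K_{y_{n−1}}} = |p|^{1/p}_{K_{y_n}}`». Prop. 2.7.1 / Thm. 6.9.1 (3): all residue valuations are real
powers of one reference absolute value (E-t3's fields `abs0`, `scale`, `absK_emb`).

INPUTS (explicit binders, with locators). `T : D.FrobeniusTransport y` — §10.13 (p430819 §1; from it `σ_y := T.residueIso : K_y ≃+* K_{ϕ(y)}`
with `σ_y (η_y b) = η_{ϕ(y)} (ϕ b)`). `hφ : ∀ a, ϕ [a] = [a^p]` — the Witt-vector Frobenius on Teichmüller representatives, print p.33 l.7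
(«`ϕ([a] − p) = [ϕ(a)] − p = [a^p] − p`»; [FF18]); NOT a field of E-t3's signature (which has `pt_frob` on points only), hence a
hypothesis here. For §3: a common target `I = (iso₀, iso₁)` (p430819) together with an absolute value `|·|_C` on `C` and exponents
`s₀, s₁` with `|iso₀ x|_C = |x|^{s₀}_{K_y}`, `|iso₁ x|_C = |x|^{s₁}_{K_{ϕ(y)}}` — «identifications compatible with the valuations up to
exponent», the only kind §10.14's «natural identification» and Prop. 2.7.1 allow (an identification moving the valuation class would
not identify VALUED fields at all). Joint non-vacuity of `T ∧ hφ` over the signature is NOT exhibited by the cell's models (E-t52's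
p434703 realises `T` with `B^{φ=p} ≠ 0`; whether its `ϕ` satisfies `hφ` is not checked here) — recorded.

WHAT IS PROVED.
* §1 **`absK_residueIso`**: `|σ_y ξ|_{K_{ϕ(y)}} = |ξ|^p_{K_y}` for EVERY `ξ ∈ K_y` (on `𝒪_{K_y}` via Teichmüller lifts — E-t3's
  `exists_teich_lift` / `absK_eta_teich` = [FF18 Prop. 2.2.17] — and `hφ`; on `|ξ| > 1` via `ξ⁻¹`). In particular
  `|p|_{K_{ϕ(y)}} = |p|^p_{K_y}` at EVERY point admitting a transport (`absK_p_frobY_of_transport`) — Thm. 10.20.1 (3) freed from the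
  parametrisation `y = y_a` of p429867's `absK_p_frobY_pt`.
* §2 **`absK_residueIso_sub`**: `|σ_y a − σ_y b|_{K_{ϕ(y)}} = |a − b|^p_{K_y}` — `σ_y` is uniformly continuous (Hölder, exponent `p`) for
  the valuation metrics, and so is its inverse: the Frobenius residue isomorphism is a HOMEOMORPHISM. (Stated metrically; no topology
  instance is put on the bare residue fields of the signature.)
* §3 For valuation-compatible identifications: **`exponent_relation`** `s₀ = p·s₁` (read off `|p|`: the two identifications CANNOT
  have the same exponent — `same_exponent_absurd` — in particular cannot both be isometries: the VALUED form of §10.15's «the field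
  `K_{y_n} = ℂ_p` is fixed» contradicts §10.13, which is Thm. 10.20.1 (3) once more); and **`exists_isometric_insertedIso`**: the
  inserted automorphism `τ = iso₁ ∘ σ_y ∘ iso₀⁻¹` of p436476 satisfies `|τ c|_C = |c|_C` — it is an ISOMETRY of `(C, |·|_C)`, a
  fortiori continuous.
LOCATED SENTENCE (no side taken; for the faithfulness lane E-ref-2 / E-ref): «In the typed frame, granted §10.13's transport and
`ϕ([a]) = [a^p]`, Thm. 10.15.1 (3) fails even with "continuous" read into it: for every pair of identifications `K_{y_{n−1}} ≃ ℂ_p`,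
`K_{y_n} ≃ ℂ_p` compatible with the valuations up to exponents, an ISOMETRIC field automorphism of `ℂ_p` makes every square commute
(`exists_isometric_insertedIso`); and no pair of identifications with equal exponents exists (`same_exponent_absurd`). What remains
to print is only an identification `K_{y_n} ≃ ℂ_p` that is not compatible with the valuations even up to exponent — outside
Prop. 2.7.1's one-value-group world. Recorded, not adjudicated.»
-/

noncomputable section

namespace Summit.ABC.IUTFork.Joshi

namespace PeriodRingDatum

variable {F B E0 : Type} [Field F] [CommRing B] [Field E0] {Y : Type} {K : Y → Type} [∀ y, Field (K y)] {G : Type}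
  {D : PeriodRingDatum F B E0 Y K G}

/-! ## 1. `σ_y` raises absolute values to the `p`-th power -/

/-- On the valuation ring: for `|ξ|_{K_y} ≤ 1`, `|σ_y ξ|_{K_{ϕ(y)}} = |ξ|^p_{K_y}` — write `ξ = η_y([x])` ([FF18 Cor. 2.2.8], E-t3's
`exists_teich_lift`), transport `σ_y (η_y [x]) = η_{ϕ(y)} (ϕ [x]) = η_{ϕ(y)} ([x^p])` (§10.13 + `hφ`), and read sizes by [FF18 Prop. 2.2.17]
(`absK_eta_teich`). [claim: Joshi2023ATS2Local, status: disputed] -/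
theorem absK_residueIso_of_le_one {y : Y} (T : D.FrobeniusTransport y) (hφ : ∀ a : F, D.frob (D.teich a) = D.teich (a ^ D.p))
    {ξ : K y} (hξ : D.absK y ξ ≤ 1) : D.absK (D.frobY y) (T.residueIso ξ) = D.absK y ξ ^ D.p := by
  obtain ⟨x, rfl⟩ := D.exists_teich_lift y ξ hξ
  rw [T.residueIso_eta, hφ, D.absK_eta_teich, D.absK_eta_teich, map_pow]

/-- **`|σ_y ξ|_{K_{ϕ(y)}} = |ξ|^p_{K_y}` for every `ξ ∈ K_y`** (the case `|ξ| > 1` through `ξ⁻¹ ∈ 𝒪_{K_y}`). [claim: Joshi2023ATS2Local, status: disputed] -/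
theorem absK_residueIso {y : Y} (T : D.FrobeniusTransport y) (hφ : ∀ a : F, D.frob (D.teich a) = D.teich (a ^ D.p)) (ξ : K y) :
    D.absK (D.frobY y) (T.residueIso ξ) = D.absK y ξ ^ D.p := by
  rcases le_or_gt (D.absK y ξ) 1 with hle | hlt
  · exact absK_residueIso_of_le_one T hφ hle
  · have hξ0 : ξ ≠ 0 := fun h => by rw [h, map_zero] at hlt; exact not_lt.2 zero_le_one hlt
    have hinv : D.absK y ξ⁻¹ ≤ 1 := by
      rw [map_inv₀]; exact inv_le_one_of_one_le₀ hlt.le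
    have h := absK_residueIso_of_le_one T hφ hinv
    rw [map_inv₀, map_inv₀, map_inv₀, inv_pow] at h
    exact inv_injective h

/-- **Thm. 10.20.1 (3) at EVERY point with a transport** (p.35 l.55–58 «`|p|_{K_{y_{n−1}}} = |p|^{1/p}_{K_{y_n}}`», forward form
`|p|_{K_{ϕ(y)}} = |p|^p_{K_y}`): `σ_y` fixes `p`. (p429867's `absK_p_frobY_pt` is the same at the parametrised points `y = y_a`.)
[claim: Joshi2023ATS2Local, status: disputed] -/
theorem absK_p_frobY_of_transport {y : Y} (T : D.FrobeniusTransport y) (hφ : ∀ a : F, D.frob (D.teich a) = D.teich (a ^ D.p)) :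
    D.absK (D.frobY y) (D.p : K (D.frobY y)) = D.absK y (D.p : K y) ^ D.p := by
  rw [← map_natCast T.residueIso D.p, absK_residueIso T hφ]

/-- Hence `scale (ϕ(y)) = p · scale y` at every point with a transport (exponent form, through E-t3's reference absolute value).
[claim: Joshi2023ATS2Local, status: disputed] -/
theorem scale_frobY_of_transport {y : Y} (T : D.FrobeniusTransport y) (hφ : ∀ a : F, D.frob (D.teich a) = D.teich (a ^ D.p)) :
    D.scale (D.frobY y) = D.p * D.scale y := by
  apply D.abs0_p_rpow_inj
  rw [← D.absK_natCast_p, absK_p_frobY_of_transport T hφ, D.absK_natCast_p, ← Real.rpow_natCast,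
    ← Real.rpow_mul D.abs0_p.1.le, mul_comm]

/-! ## 2. `σ_y` is uniformly continuous for the valuation metrics (Hölder with exponent `p`) -/

/-- **`|σ_y a − σ_y b|_{K_{ϕ(y)}} = |a − b|^p_{K_y}`**: the Frobenius residue isomorphism is uniformly continuous — indeed a homeomorphism,
its inverse being Hölder with exponent `1/p` — for the metrics `|· − ·|`. [claim: Joshi2023ATS2Local, status: disputed] -/
theorem absK_residueIso_sub {y : Y} (T : D.FrobeniusTransport y) (hφ : ∀ a : F, D.frob (D.teich a) = D.teich (a ^ D.p))
    (a b : K y) : D.absK (D.frobY y) (T.residueIso a - T.residueIso b) = D.absK y (a - b) ^ D.p := by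
  rw [← map_sub, absK_residueIso T hφ]

/-- `ε`-`δ` form: `|a − b|_{K_y} < δ ⟹ |σ_y a − σ_y b|_{K_{ϕ(y)}} < δ^p`. [folklore] -/
theorem absK_residueIso_sub_lt {y : Y} (T : D.FrobeniusTransport y) (hφ : ∀ a : F, D.frob (D.teich a) = D.teich (a ^ D.p))
    {a b : K y} {δ : ℝ} (h : D.absK y (a - b) < δ) :
    D.absK (D.frobY y) (T.residueIso a - T.residueIso b) < δ ^ D.p := by
  rw [absK_residueIso_sub T hφ]
  exact pow_lt_pow_left₀ h ((D.absK y).nonneg _) D.p_prime.ne_zero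

/-! ## 3. Valuation-compatible identifications with `ℂ_p`: the inserted automorphism is an isometry -/

section ValuedTarget

variable {C : Type} [Field C] {y : Y} (T : D.FrobeniusTransport y) (hφ : ∀ a : F, D.frob (D.teich a) = D.teich (a ^ D.p))
  (I : D.CommonTarget C y) (absC : AbsoluteValue C ℝ) {s₀ s₁ : ℝ}
  (h₀ : ∀ x : K y, absC (I.iso₀ x) = D.absK y x ^ s₀) (h₁ : ∀ x : K (D.frobY y), absC (I.iso₁ x) = D.absK (D.frobY y) x ^ s₁)

include T hφ h₀ h₁

/-- **The two identifications CANNOT have the same exponent: `s₀ = p · s₁`.** Read off `p`: `|p|_C = |p|^{s₀}_{K_y} = |p|^{s₁}_{K_{ϕ(y)}} =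
|p|^{p·s₁}_{K_y}` (§1), and `0 < |p|_{K_y} < 1` pins the exponent (through E-t3's `abs0`, `scale`). [claim: Joshi2023ATS2Local, status: disputed] -/
theorem exponent_relation : s₀ = D.p * s₁ := by
  have e₀ : absC (D.p : C) = D.absK y (D.p : K y) ^ s₀ := by rw [← map_natCast I.iso₀ D.p, h₀]
  have e₁ : absC (D.p : C) = D.absK (D.frobY y) (D.p : K (D.frobY y)) ^ s₁ := by rw [← map_natCast I.iso₁ D.p, h₁]
  rw [e₀, absK_p_frobY_of_transport T hφ, D.absK_natCast_p, ← Real.rpow_natCast, ← Real.rpow_mul D.abs0_p.1.le,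
    ← Real.rpow_mul D.abs0_p.1.le, ← Real.rpow_mul D.abs0_p.1.le] at e₁
  have h := D.abs0_p_rpow_inj e₁
  have hs : D.scale y ≠ 0 := (D.scale_pos y).ne'
  have : D.scale y * s₀ = D.scale y * (D.p * s₁) := by rw [h]; ring
  exact mul_left_cancel₀ hs this

/-- **In particular no pair of identifications with EQUAL NONZERO exponents exists** — e.g. `K_y` and `K_{ϕ(y)}` cannot BOTH be identified
isometrically with `(C, |·|_C)`: the valued reading of «the field `K_{y_n} = ℂ_p` is fixed» (§10.15 p.33 l.21) contradicts §10.13, which is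
Thm. 10.20.1 (3) seen from `C`. [claim: Joshi2023ATS2Local, status: disputed] -/
theorem same_exponent_absurd (hs : s₀ = s₁) (hs₁ : s₁ ≠ 0) : False := by
  have h := exponent_relation T hφ I absC h₀ h₁
  rw [hs] at h
  have hp : (1 : ℝ) < D.p := by exact_mod_cast D.p_prime.one_lt
  have : (D.p : ℝ) * s₁ - s₁ = 0 := by rw [← h, sub_self]
  have h2 : ((D.p : ℝ) - 1) * s₁ = 0 := by rw [sub_mul, one_mul, this]
  rcases mul_eq_zero.1 h2 with h3 | h3
  · linarith
  · exact hs₁ h3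

/-- **The inserted automorphism is an ISOMETRY.** For `τ := iso₁ ∘ σ_y ∘ iso₀⁻¹` (p436476's witness against `NoInsertedIso I`):
`|τ c|_C = |σ_y x|^{s₁}_{K_{ϕ(y)}} = |x|^{p·s₁}_{K_y} = |x|^{s₀}_{K_y} = |c|_C` with `x = iso₀⁻¹ c`. [claim: Joshi2023ATS2Local, status: disputed] -/
theorem absC_insertedIso (c : C) : absC (I.iso₁ (T.residueIso (I.iso₀.symm c))) = absC c := by
  have hs := exponent_relation T hφ I absC h₀ h₁
  conv_rhs => rw [← I.iso₀.apply_symm_apply c, h₀, hs, Real.rpow_mul ((D.absK y).nonneg _), Real.rpow_natCast]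
  rw [h₁, absK_residueIso T hφ]

/-- **Thm. 10.15.1 (3) WITH CONTINUITY, in the typed frame: an ISOMETRIC (a fortiori continuous) field automorphism of `C` can be
inserted** so that every square commutes (on all of `B`), for every pair of identifications compatible with the valuations up to
exponents. Located, not adjudicated — see the module docstring for what is left to print. [claim: Joshi2023ATS2Local, status: disputed] -/
theorem exists_isometric_insertedIso :
    ∃ τ : C ≃+* C, (∀ b : B, τ (I.log₀ b) = I.log₁ (D.frob b)) ∧ ∀ c : C, absC (τ c) = absC c :=
  ⟨I.iso₀.symm.trans (T.residueIso.trans I.iso₁),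
    fun b => by
      simp only [CommonTarget.log₀, CommonTarget.log₁, RingEquiv.trans_apply, RingEquiv.symm_apply_apply, T.residueIso_eta],
    fun c => by simpa only [RingEquiv.trans_apply] using absC_insertedIso T hφ I absC h₀ h₁ c⟩

/-- … and it is uniformly continuous in the plainest form: `|τ a − τ c|_C = |a − c|_C`. [claim: Joshi2023ATS2Local, status: disputed] -/
theorem exists_insertedIso_dist_eq :
    ∃ τ : C ≃+* C, (∀ b : B, τ (I.log₀ b) = I.log₁ (D.frob b)) ∧ ∀ a c : C, absC (τ a - τ c) = absC (a - c) := by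
  obtain ⟨τ, hτ, hiso⟩ := exists_isometric_insertedIso T hφ I absC h₀ h₁
  exact ⟨τ, hτ, fun a c => by rw [← map_sub, hiso]⟩

end ValuedTarget

end PeriodRingDatum

end Summit.ABC.IUTFork.Joshi

end
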